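import Mathlib

/-!
# `AbelianNoGo` — vocabulary: orbit harmonics of a free orbit of a finite abelian group

Route `MatrixMultiplication/OrbitHarmonicsHosts`, support item `stmt-MatrixMultiplication-5456`
(`AbelianNoGo`).  Definitions + their immediate API only; no statement of the route is asserted
here.  Everything lives "upstairs" in the polynomial ring `ℂ[x_1..x_d]`, describing the
orbit-harmonics ring `gr(P) = ℂ[x]/J`, `J = span LF(I(P))` (the ring written inline in the route
statement), of the orbit `P = Γ·v` of a finite abelian group `Γ` acting linearly through
`ρV : Γ → GL_d(ℂ)`:

* `pt`, `ev` (evaluation on the orbit, an algebra map `ℂ[x] → (Γ → ℂ)` whose kernel is the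
  vanishing ideal `I(P)`), `subst` (the linear substitution `f ↦ f(ρV(g)·x)`, which `ev`
  intertwines with translation on `Γ`, and which preserves homogeneous components);
* `ev_surjective` (multivariate Lagrange interpolation on the finite point set `P`);
* the degree filtration `filt k = ev(ℂ[x]_{≤ k})` of `Fun(Γ)` and the *level* `lev χ` of a
  character `χ : Γ →* ℂˣ` (the least `k` with `χ ∈ filt k`);
* `grIdeal` (the ideal `J`, literally the ideal of the route statement with `P = range pt`) and
  `phi χ` (a homogeneous lift of `χ` of degree `lev χ`, chosen by `Classical.choice`; its
  existence on a free orbit is `phi_spec` in the companion file).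

No Mathlib notion is duplicated: Mathlib has `MvPolynomial.vanishingIdeal`, `homogeneousComponent`,
`restrictTotalDegree` (all used here) but no orbit harmonics / associated graded of a point
set.  The weight-vector calculus built on this vocabulary (levels of products, the structure of
`gr(P)` as a graded `Γ`-module) is in the companion file `OrbitHarmonicsHostsAbelianNoGoWeights`.
-/

-- single-conjunct summit: the mandated namespace repeats `MatrixMultiplication`.
set_option linter.dupNamespace false

namespace Summit.MatrixMultiplication.MatrixMultiplication.Theorems

namespace AbelianNoGo

open MvPolynomial

variable {Γ : Type*} [CommGroup Γ] {d : ℕ}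

section Defs

variable (ρV : Γ →* GL (Fin d) ℂ) (v : Fin d → ℂ)

/-- The orbit point `g • v = ρV(g) v ∈ ℂ^d`. [folklore] -/
def pt (g : Γ) : Fin d → ℂ := (ρV g : Matrix (Fin d) (Fin d) ℂ).mulVec v

/-- The linear substitution `f ↦ f(ρV(g) x)` on `ℂ[x_1..x_d]` (the action through which the route
states equivariance). [folklore] -/
noncomputable def subst (g : Γ) : MvPolynomial (Fin d) ℂ →ₐ[ℂ] MvPolynomial (Fin d) ℂ :=
  aeval fun i : Fin d => ∑ j : Fin d,
    (ρV g : Matrix (Fin d) (Fin d) ℂ) i j • (X j : MvPolynomial (Fin d) ℂ)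

/-- Evaluation of polynomials on the orbit `Γ·v`, as functions on `Γ`. [folklore] -/
noncomputable def ev : MvPolynomial (Fin d) ℂ →ₐ[ℂ] (Γ → ℂ) :=
  AlgHom.pi fun g => (aeval (pt ρV v g) : MvPolynomial (Fin d) ℂ →ₐ[ℂ] ℂ)

/-- The ideal `J = span LF(I(P))` generated by the top-degree forms of the polynomials vanishing
on the orbit `P = Γ·v` (so `ℂ[x]/J` is the orbit-harmonics ring `gr(P)`). [folklore] -/
noncomputable def grIdeal : Ideal (MvPolynomial (Fin d) ℂ) :=
  Ideal.span ((fun f : MvPolynomial (Fin d) ℂ => homogeneousComponent f.totalDegree f) ''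
    ((vanishingIdeal ℂ (Set.range (pt ρV v)) : Ideal (MvPolynomial (Fin d) ℂ)) :
      Set (MvPolynomial (Fin d) ℂ)))

/-- The degree filtration of the functions on the orbit: `filt k = ev (ℂ[x]_{≤ k})`. [folklore] -/
noncomputable def filt (k : ℕ) : Submodule ℂ (Γ → ℂ) :=
  (restrictTotalDegree (Fin d) ℂ k).map (ev ρV v).toLinearMap

/-- The function `g ↦ χ(g)` of a character `χ : Γ →* ℂˣ`. [folklore] -/
def fn (χ : Γ →* ℂˣ) : Γ → ℂ := fun g => ((χ g : ℂˣ) : ℂ)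

/-- The *level* of a character: the least `k` such that `χ`, as a function on the orbit, is the
restriction of a polynomial of degree `≤ k` (the degree in which `χ` sits in `gr(P)`).
[folklore] -/
noncomputable def lev (χ : Γ →* ℂˣ) : ℕ := sInf {k | fn χ ∈ filt ρV v k}

open scoped Classical in
/-- A homogeneous polynomial of degree `lev χ` restricting to `χ` on the orbit — a homogeneous
lift of the weight vector `f_χ` of the orbit-harmonics ring (`0` if none exists; on a free orbit
one always exists, `phi_spec` in the companion file). [folklore] -/
noncomputable def phi (χ : Γ →* ℂˣ) : MvPolynomial (Fin d) ℂ :=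
  if h : ∃ φ : MvPolynomial (Fin d) ℂ, φ.IsHomogeneous (lev ρV v χ) ∧ ev ρV v φ = fn χ
  then h.choose else 0

end Defs

variable {ρV : Γ →* GL (Fin d) ℂ} {v : Fin d → ℂ}

/-! ### Evaluation, substitution and the vanishing ideal -/

/-- `ev f g = f(g • v)`. [folklore] -/
@[simp] lemma ev_apply (f : MvPolynomial (Fin d) ℂ) (g : Γ) :
    ev ρV v f g = eval (pt ρV v g) f := rfl

/-- Membership in the vanishing ideal of the orbit is `ev f = 0`. [folklore] -/
lemma mem_vanishingIdeal_iff_ev (f : MvPolynomial (Fin d) ℂ) :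
    f ∈ vanishingIdeal ℂ (Set.range (pt ρV v)) ↔ ev ρV v f = 0 := by
  rw [mem_vanishingIdeal_iff, Set.forall_mem_range]
  constructor
  · intro h
    funext g
    exact h g
  · intro h g
    exact congrFun h g

/-- `fn (χ ψ) = fn χ * fn ψ`. [folklore] -/
lemma fn_mul (χ ψ : Γ →* ℂˣ) : fn (χ * ψ) = fn χ * fn ψ := by
  funext g
  simp [fn]

/-- `fn χ (g h) = fn χ g * fn χ h`. [folklore] -/
lemma fn_apply_mul (χ : Γ →* ℂˣ) (g h : Γ) : fn χ (g * h) = fn χ g * fn χ h := by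
  simp [fn]

/-- `fn χ` vanishes nowhere. [folklore] -/
lemma fn_ne_zero (χ : Γ →* ℂˣ) (g : Γ) : fn χ g ≠ 0 := (χ g).ne_zero

/-- Orbit points multiply: `(g h) • v = ρV(g) (h • v)`. [folklore] -/
lemma pt_mul (g h : Γ) : pt ρV v (g * h) = (ρV g : Matrix (Fin d) (Fin d) ℂ).mulVec (pt ρV v h) := by
  simp [pt, Matrix.mulVec_mulVec]

/-- Evaluating a substituted polynomial: `(subst g f)(x) = f(ρV(g) x)`. [folklore] -/
lemma aeval_subst (g : Γ) (x : Fin d → ℂ) (f : MvPolynomial (Fin d) ℂ) :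
    aeval x (subst ρV g f) = aeval ((ρV g : Matrix (Fin d) (Fin d) ℂ).mulVec x) f := by
  rw [subst, aeval_eq_bind₁, aeval_bind₁]
  have hL : (fun i : Fin d => aeval x (∑ j : Fin d,
      (ρV g : Matrix (Fin d) (Fin d) ℂ) i j • (X j : MvPolynomial (Fin d) ℂ))) =
      (ρV g : Matrix (Fin d) (Fin d) ℂ).mulVec x := by
    funext i
    simp [Matrix.mulVec, dotProduct]
  rw [hL]

/-- Evaluating a substituted polynomial (`eval` form). [folklore] -/
lemma eval_subst (g : Γ) (x : Fin d → ℂ) (f : MvPolynomial (Fin d) ℂ) :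
    eval x (subst ρV g f) = eval ((ρV g : Matrix (Fin d) (Fin d) ℂ).mulVec x) f :=
  aeval_subst g x f

/-- `ev` intertwines `subst g` with translation by `g`: `ev (subst g f) h = ev f (g h)`. [folklore] -/
lemma ev_subst (g : Γ) (f : MvPolynomial (Fin d) ℂ) :
    ev ρV v (subst ρV g f) = fun h => ev ρV v f (g * h) := by
  funext h
  rw [ev_apply, ev_apply, eval_subst, pt_mul]

/-- Substitutions compose: `subst g ∘ subst h = subst (h g)`. [folklore] -/
lemma subst_subst (g h : Γ) (f : MvPolynomial (Fin d) ℂ) :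
    subst ρV g (subst ρV h f) = subst ρV (h * g) f := by
  apply MvPolynomial.funext
  intro x
  rw [eval_subst, eval_subst, eval_subst, map_mul, Units.val_mul, Matrix.mulVec_mulVec]

/-- `subst g` maps homogeneous polynomials to homogeneous polynomials of the same degree.
[folklore] -/
lemma isHomogeneous_subst (g : Γ) {f : MvPolynomial (Fin d) ℂ} {n : ℕ} (hf : f.IsHomogeneous n) :
    (subst ρV g f).IsHomogeneous n := by
  have hlin : ∀ i : Fin d, (∑ j : Fin d, (ρV g : Matrix (Fin d) (Fin d) ℂ) i j •
      (X j : MvPolynomial (Fin d) ℂ)).IsHomogeneous 1 := by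
    intro i
    refine IsHomogeneous.sum _ _ _ fun j _ => ?_
    rw [smul_eq_C_mul]
    exact (isHomogeneous_X ℂ j).C_mul _
  have h := hf.aeval _ hlin
  rw [one_mul] at h
  exact h

/-- `subst g` commutes with taking homogeneous components. [folklore] -/
lemma subst_homogeneousComponent (g : Γ) (k : ℕ) (f : MvPolynomial (Fin d) ℂ) :
    subst ρV g (homogeneousComponent k f) = homogeneousComponent k (subst ρV g f) := by
  classical
  conv_rhs => rw [← sum_homogeneousComponent f]
  rw [map_sum, map_sum]
  have h : ∀ i, homogeneousComponent k (subst ρV g (homogeneousComponent i f)) =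
      if k = i then subst ρV g (homogeneousComponent i f) else 0 := fun i =>
    homogeneousComponent_of_mem ((mem_homogeneousSubmodule i _).2
      (isHomogeneous_subst g (homogeneousComponent_isHomogeneous i f)))
  simp only [h, Finset.sum_ite_eq, Finset.mem_range]
  split_ifs with hk
  · rfl
  · have hk' : f.totalDegree < k := by omega
    rw [homogeneousComponent_eq_zero k f hk', map_zero]

/-! ### Weight vectors -/

/-- A function on `Γ` transforming under translation by the character `χ` is a multiple of `χ`.
[folklore] -/
lemma eq_smul_fn_of_weight {φ : Γ → ℂ} {χ : Γ →* ℂˣ}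
    (h : ∀ g h' : Γ, φ (g * h') = fn χ g * φ h') : φ = φ 1 • fn χ := by
  funext g
  have := h g 1
  rw [mul_one] at this
  simp [this, mul_comm]

/-- The evaluation of a weight vector of weight `χ` is a multiple of `χ`. [folklore] -/
lemma ev_of_weight {f : MvPolynomial (Fin d) ℂ} {χ : Γ →* ℂˣ}
    (h : ∀ g, subst ρV g f = fn χ g • f) : ev ρV v f = ev ρV v f 1 • fn χ := by
  apply eq_smul_fn_of_weight
  intro g h'
  have := congrFun (ev_subst (ρV := ρV) (v := v) g f) h'
  rw [h g, map_smul] at this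
  simpa using this.symm

/-- Homogeneous components of a weight vector are weight vectors. [folklore] -/
lemma weight_homogeneousComponent {f : MvPolynomial (Fin d) ℂ} {χ : Γ →* ℂˣ}
    (h : ∀ g, subst ρV g f = fn χ g • f) (k : ℕ) (g : Γ) :
    subst ρV g (homogeneousComponent k f) = fn χ g • homogeneousComponent k f := by
  rw [subst_homogeneousComponent, h g, map_smul]

/-! ### Interpolation: `ev` is onto when the orbit is free -/

/-- Lagrange interpolation on the finite point set `Γ·v`: every function on a free orbit is the
restriction of a polynomial. [folklore] -/
theorem ev_surjective [Fintype Γ] (hinj : Function.Injective (pt ρV v)) :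
    Function.Surjective (ev ρV v) := by
  classical
  -- separating linear polynomials
  have hsep : ∀ h g : Γ, g ≠ h → ∃ L : MvPolynomial (Fin d) ℂ,
      eval (pt ρV v h) L = 1 ∧ eval (pt ρV v g) L = 0 := by
    intro h g hgh
    have hne : pt ρV v g ≠ pt ρV v h := fun e => hgh (hinj e)
    obtain ⟨i, hi⟩ := Function.ne_iff.mp hne
    refine ⟨C (pt ρV v h i - pt ρV v g i)⁻¹ * (X i - C (pt ρV v g i)), ?_, ?_⟩
    · simp only [map_mul, eval_C, map_sub, eval_X]
      exact inv_mul_cancel₀ (sub_ne_zero.mpr (Ne.symm hi))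
    · simp
  choose! L hL1 hL0 using hsep
  -- indicator polynomials
  let δ : Γ → MvPolynomial (Fin d) ℂ := fun h => ∏ g ∈ Finset.univ.erase h, L h g
  have hδ : ∀ h g, eval (pt ρV v g) (δ h) = if g = h then 1 else 0 := by
    intro h g
    simp only [δ, map_prod]
    split_ifs with hgh
    · subst hgh
      exact Finset.prod_eq_one fun g' hg' => hL1 g g' (Finset.ne_of_mem_erase hg')
    · exact Finset.prod_eq_zero (Finset.mem_erase.mpr ⟨hgh, Finset.mem_univ g⟩) (hL0 h g hgh)
  intro φ
  refine ⟨∑ h, φ h • δ h, ?_⟩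
  funext g
  simp only [ev_apply, map_sum, smul_eval, hδ, mul_ite, mul_one, mul_zero, Finset.sum_ite_eq,
    Finset.mem_univ, if_true]

/-! ### The degree filtration and levels -/

/-- Membership in the filtration. [folklore] -/
lemma mem_filt_iff {φ : Γ → ℂ} {k : ℕ} :
    φ ∈ filt ρV v k ↔ ∃ f : MvPolynomial (Fin d) ℂ, f.totalDegree ≤ k ∧ ev ρV v f = φ := by
  simp [filt, Submodule.mem_map, mem_restrictTotalDegree]

/-- Every character has a level (the filtration is exhaustive on a free orbit). [folklore] -/
lemma exists_mem_filt [Fintype Γ] (hinj : Function.Injective (pt ρV v)) (χ : Γ →* ℂˣ) :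
    ∃ k, fn χ ∈ filt ρV v k := by
  obtain ⟨f, hf⟩ := ev_surjective hinj (fn χ)
  exact ⟨f.totalDegree, mem_filt_iff.2 ⟨f, le_rfl, hf⟩⟩

/-- `χ` lies in the filtration step of its level. [folklore] -/
lemma fn_mem_filt_lev [Fintype Γ] (hinj : Function.Injective (pt ρV v)) (χ : Γ →* ℂˣ) :
    fn χ ∈ filt ρV v (lev ρV v χ) :=
  Nat.sInf_mem (exists_mem_filt hinj χ)

/-- The level is minimal. [folklore] -/
lemma lev_le {χ : Γ →* ℂˣ} {k : ℕ} (h : fn χ ∈ filt ρV v k) : lev ρV v χ ≤ k :=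
  Nat.sInf_le h

/-- Below its level a character is not in the filtration. [folklore] -/
lemma fn_notMem_filt {χ : Γ →* ℂˣ} {k : ℕ} (h : k < lev ρV v χ) : fn χ ∉ filt ρV v k :=
  Nat.notMem_of_lt_sInf h

/-- A weight vector of weight `χ` and degree below the level of `χ` vanishes on the orbit.
[folklore] -/
lemma ev_eq_zero_of_weight_of_lt {f : MvPolynomial (Fin d) ℂ} {χ : Γ →* ℂˣ} {k : ℕ}
    (hw : ∀ g, subst ρV g f = fn χ g • f) (hk : f.totalDegree ≤ k) (hlt : k < lev ρV v χ) :
    ev ρV v f = 0 := by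
  have hev := ev_of_weight (v := v) hw
  set c := ev ρV v f 1 with hc_def
  by_cases hc : c = 0
  · rw [hev, hc, zero_smul]
  · exfalso
    refine fn_notMem_filt hlt (mem_filt_iff.2 ⟨c⁻¹ • f, ?_, ?_⟩)
    · exact (totalDegree_smul_le _ _).trans hk
    · rw [map_smul, hev, smul_smul, inv_mul_cancel₀ hc, one_smul]

end AbelianNoGo

end Summit.MatrixMultiplication.MatrixMultiplication.Theorems
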